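import Literature.Analysis.Matrix.KrylovShiftedSystems
import Mathlib.FieldTheory.IsAlgClosed.Basic
import Mathlib.Analysis.Complex.Polynomial.Basic
import HarnessLib

/-!
# The zeros of the CG (Lanczos / Galerkin) residual polynomial and the multi-shift factor
`ζ^σ_m = ∏ θ/(θ + σ) ∈ (0, 1]`

Sequel to `KrylovShiftedSystems.lean` (collinear shifted residuals, `ζ^σ_m = 1/p_m(−σ)`).  Here the
sign and size of the factor are settled for symmetric positive definite `A` and non-negative
shifts, by locating the zeros of the seed residual polynomial.

Source.  J. van den Eshof, A. Frommer, Th. Lippert, K. Schilling, H. A. van der Vorst, *Numerical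
methods for the QCD overlap operator. I. Sign-function and error bounds*, Comput. Phys. Commun. 146
(2002) 203 = hep-lat/0202025 [VanDenEshofEtAl2002] (held text `paper:arxiv-hep-lat_0202025`,
p0009–p0010), §4:
> **Lemma 5.** Let `r_k` denote the CG residual for `k` steps CG when solving `Ax = b` and,
> similarly, `r_k^τ` for solving `(A + τI)x = b`, both methods starting with the initial iterate
> zero. Then `r_k^τ = φ_k^τ r_k` with `φ_k^τ ≡ ∏_{j=1}^k θ_{j,k}/(θ_{j,k} + τ)`, where `θ_{j,k}` denotes
> the `j`-th eigenvalue of `T_k`.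
> *Proof.* From e.g. [PPV95] we have the following polynomial characterizations for the residuals
> `r_k = π_k(A)b/π_k(0)`, `π_k(t) ≡ det(tI − T_k)`; `r_k^τ = π_k^τ(A+τI)b/π_k^τ(0)`,
> `π_k^τ(t) ≡ det(tI − (T_k + τI))` …
and, in the proof of Theorem 6, "Since `0 ≤ φ_k^{t²} ≤ 1` …".  (`T_k` = the Lanczos tridiagonal
matrix, "We refer to the eigenvalues of `T_k` as the Ritz values", p0007; [PPV95] = Paige, Parlett,
van der Vorst, Numer. Linear Algebra Appl. 2 (1995) 115.)  Also B. Jegerlehner, hep-lat/9612014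
[Jegerlehner1996] §3.1: "`A` has to be chosen in a way that `ζ_i^σ ≤ 1` … which means that `σ = 0`
corresponds usually to the system with the slowest convergence", §2.2: "the shifted systems still
converge if `ζ_i ≤ 1`".

What is typed (real symmetric `A`, the tree's Galerkin–Krylov iterate `IsCGIterate`, shift
`A + σ • 1`; the Lanczos matrix `T_k` itself is NOT formalised — in its place the zeros are
located directly):
* §1 `dotProduct_mulVec_mem_Icc` — Rayleigh bounds `α uᵀu ≤ uᵀAu ≤ β uᵀu` from the spectral interval.
* §2 For a polynomial `p ≠ 0` with `deg p ≤ m` and `p(A) b ⊥ 𝒦_m(A, b)` (the seed residual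
  polynomial has these properties, `KrylovShiftedSystems`), in the no-breakdown regime
  (`b, Ab, …, A^m b` independent): `natDegree_eq_of_galerkin` (`deg p = m` exactly);
  `exists_rayleigh_of_isRoot`, `root_mem_Icc` — every REAL zero `θ` of `p` is a Rayleigh quotient
  `uᵀAu/uᵀu` of a nonzero `u ∈ 𝒦_m(A, b)` (divide out `X − θ`), hence lies in the spectral interval
  `[α, β]` (in print: the zeros are the Ritz values = eigenvalues of `T_k` [PPV95]; the
  identification with `T_k` is not made here); `im_eq_zero_of_aeval_eq_zero` — every COMPLEX zero
  is real (divide out the real quadratic `(X − Re z)² + (Im z)²`: its cofactor `q` would give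
  `‖(A − Re z)q(A)b‖² + (Im z)²‖q(A)b‖² = 0`).
* §3 `exists_multiset_eval_eq_prod` — hence `p(t) = lc(p) · ∏_{θ ∈ s}(t − θ)` over a multiset `s`
  of `m` real zeros, all in `[α, β]` ("`r_k = π_k(A)b/π_k(0)`, `π_k(t) = det(tI − T_k) = ∏(t − θ_{j,k})`").
* §4 THE MULTI-SHIFT FACTOR (Lemma 5 with "`0 ≤ φ ≤ 1`"): for `A` symmetric positive definite,
  `IsCGIterate.shifted_residual_eq_prod_smul` — in the no-breakdown regime and for EVERY real
  shift `σ` for which the shifted Galerkin iterate exists, `b − (A+σ)x' = (∏_{θ∈s} θ/(θ+σ)) · (b − Ax)`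
  with `s` the zeros of the seed residual polynomial, all in `[λ_min, λ_max]`;
  `IsCGIterate.exists_shifted_residual_eq_smul_of_posDef` — for `σ ≥ 0`, UNCONDITIONALLY (breakdown
  ⇒ both residuals vanish), `b − (A+σ)x' = ζ (b − Ax)` with `0 < ζ ≤ 1`; hence
  `IsCGIterate.shifted_residual_normSq_le` — `‖r^σ_m‖² ≤ ‖r_m‖²`: among the systems `A + σ`,
  `σ ≥ 0`, solved together by CG-M, the seed `σ = 0` has the largest residual at every step
  (Jegerlehner's "σ = 0 corresponds … to the system with the slowest convergence", exactly, in
  residual norm).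

Not here: the Lanczos matrix `T_k`, Ritz VECTORS, interlacing / distinctness of the zeros, the
`A⁻¹`-norm or energy-norm comparisons, finite precision; complex Hermitian `A`
(`TODO(general form)`, as in the parent files).

## References
* [VanDenEshofEtAl2002] J. van den Eshof et al., CPC 146 (2002) 203, §4 Lemma 5 and proof of
  Theorem 6 (p0009–p0010 of hep-lat/0202025); p0007 (Ritz values), p0008 ("the Lanczos polynomial
  … is equal to `π_k(t) ≡ det(tI − T_k)`, see [PPV95]").
* [Jegerlehner1996] B. Jegerlehner, hep-lat/9612014, §2.2, §3.1.
* [Saad2003] Y. Saad, Iterative Methods for Sparse Linear Systems, §6.2 Proposition 6.2 (no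
  breakdown ⇔ independence), through `KrylovShiftedSystems`.
* [HornJohnson2013] (through `KyFanMaximumPrinciple`: Rayleigh quotient expansion Thm 4.1.5/4.2.2).
-/

noncomputable section

open scoped Matrix
open Finset Polynomial

namespace Literature.Analysis.Matrix

namespace ConjugateGradient

open _root_.Matrix

variable {ι : Type*} [Fintype ι] [DecidableEq ι]

/-! ### §1 Rayleigh bounds from the spectral interval -/

/-- **Rayleigh bounds**: if the eigenvalues of the real symmetric `A` lie in `[α, β]` then
`α·uᵀu ≤ uᵀAu ≤ β·uᵀu` for every `u`. [cite: HornJohnson2013, Thm. 4.2.2 (Rayleigh quotient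
theorem)] -/
theorem dotProduct_mulVec_mem_Icc {A : Matrix ι ι ℝ} (hA : A.IsHermitian) {α β : ℝ}
    (hspec : ∀ i, hA.eigenvalues i ∈ Set.Icc α β) (u : ι → ℝ) :
    α * (u ⬝ᵥ u) ≤ u ⬝ᵥ A *ᵥ u ∧ u ⬝ᵥ A *ᵥ u ≤ β * (u ⬝ᵥ u) := by
  rw [KyFan.dotProduct_mulVec_eq_sum_eigen hA u, KyFan.dotProduct_self_eq_sum_sq hA u, mul_sum,
    mul_sum]
  exact ⟨sum_le_sum fun i _ => mul_le_mul_of_nonneg_right (hspec i).1 (sq_nonneg _),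
    sum_le_sum fun i _ => mul_le_mul_of_nonneg_right (hspec i).2 (sq_nonneg _)⟩

omit [DecidableEq ι] in
/-- `uᵀu ≥ 0`. [folklore] -/
private theorem dotProduct_self_nonneg' (u : ι → ℝ) : 0 ≤ u ⬝ᵥ u := by
  rw [dotProduct]
  exact sum_nonneg fun i _ => mul_self_nonneg _

omit [DecidableEq ι] in
/-- `u ≠ 0 ⇒ uᵀu > 0`. [folklore] -/
private theorem dotProduct_self_pos' {u : ι → ℝ} (hu : u ≠ 0) : 0 < u ⬝ᵥ u :=
  lt_of_le_of_ne (dotProduct_self_nonneg' u) fun h => hu (dotProduct_self_eq_zero.mp h.symm)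

/-! ### §2 Zeros of a Galerkin residual polynomial (no-breakdown regime) -/

/-- `q(A) v ∈ 𝒦_m(A, v)` when `natDegree q < m`. [cite: Saad2003, §6.2 eq. (6.2)] -/
theorem aeval_mulVec_mem_krylov_of_natDegree_lt {A : Matrix ι ι ℝ} {v : ι → ℝ} {m : ℕ} {q : ℝ[X]}
    (hq : q.natDegree < m) : aeval A q *ᵥ v ∈ krylov A v m :=
  aeval_mulVec_mem_krylov (lt_of_le_of_lt degree_le_natDegree (by exact_mod_cast hq))

/-- **The residual polynomial has exact degree `m`** (no breakdown): if `b, Ab, …, A^m b` are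
independent, `p ≠ 0`, `deg p ≤ m` and `p(A) b ⊥ 𝒦_m(A, b)`, then `deg p = m` — otherwise
`p(A)b ∈ 𝒦_m` would be orthogonal to itself. [cite: VanDenEshofEtAl2002, §4 proof of Lemma 5
("`r_k = π_k(A)b/π_k(0)`, `π_k(t) ≡ det(tI − T_k)`" — a polynomial of degree exactly k);
Saad2003, §6.2 Proposition 6.2] -/
theorem natDegree_eq_of_galerkin {A : Matrix ι ι ℝ} {b : ι → ℝ} {m : ℕ} {p : ℝ[X]}
    (hind : LinearIndependent ℝ (fun j : Fin (m + 1) => (A ^ (j : ℕ)) *ᵥ b)) (hp : p ≠ 0)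
    (hpdeg : p.natDegree ≤ m) (horth : ∀ w ∈ krylov A b m, w ⬝ᵥ (aeval A p *ᵥ b) = 0) :
    p.natDegree = m := by
  by_contra hne
  have hmem := aeval_mulVec_mem_krylov_of_natDegree_lt (A := A) (v := b) (lt_of_le_of_ne hpdeg hne)
  exact hp (eq_zero_of_aeval_mulVec_eq_zero hind hpdeg (dotProduct_self_eq_zero.mp (horth _ hmem)))

/-- **Every real zero of the residual polynomial is a Rayleigh quotient on the Krylov space.**
In the no-breakdown regime, if `p ≠ 0`, `deg p ≤ m`, `p(A) b ⊥ 𝒦_m(A, b)` and `p(θ) = 0`, then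
`θ = uᵀAu/uᵀu` for the nonzero Krylov vector `u = q(A) b`, `p = (X − θ) q`: indeed
`0 = (u, p(A)b) = (u, (A − θ)u)`.  (In print: the zeros of the Lanczos/CG residual polynomial
`π_k(t) = det(tI − T_k)` are the Ritz values, the eigenvalues of `T_k = V_kᵀ A V_k` [PPV95]; the
matrix `T_k` is not formalised here.) [cite: VanDenEshofEtAl2002, §4 Lemma 5 (proof, citing
[PPV95]) and §3 ("We refer to the eigenvalues of T_k as the Ritz values")] -/
theorem exists_rayleigh_of_isRoot {A : Matrix ι ι ℝ} {b : ι → ℝ} {m : ℕ} {p : ℝ[X]}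
    (hind : LinearIndependent ℝ (fun j : Fin (m + 1) => (A ^ (j : ℕ)) *ᵥ b)) (hp : p ≠ 0)
    (hpdeg : p.natDegree ≤ m) (horth : ∀ w ∈ krylov A b m, w ⬝ᵥ (aeval A p *ᵥ b) = 0)
    {θ : ℝ} (hθ : p.IsRoot θ) :
    ∃ u : ι → ℝ, u ∈ krylov A b m ∧ u ≠ 0 ∧ u ⬝ᵥ A *ᵥ u = θ * (u ⬝ᵥ u) := by
  set q := p /ₘ (X - C θ) with hq
  have hfac : (X - C θ) * q = p := mul_divByMonic_eq_iff_isRoot.mpr hθ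
  have hq0 : q ≠ 0 := by
    intro h0
    rw [h0, mul_zero] at hfac
    exact hp hfac.symm
  have hqdeg : q.natDegree + 1 = p.natDegree := by
    have h := congr_arg natDegree hfac
    rw [natDegree_mul (X_sub_C_ne_zero θ) hq0, natDegree_X_sub_C] at h
    omega
  have hqlt : q.natDegree < m := by omega
  refine ⟨aeval A q *ᵥ b, aeval_mulVec_mem_krylov_of_natDegree_lt hqlt,
    fun h0 => hq0 (eq_zero_of_aeval_mulVec_eq_zero hind (by omega) h0), ?_⟩
  have h := horth _ (aeval_mulVec_mem_krylov_of_natDegree_lt hqlt)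
  rw [← hfac, map_mul, map_sub, aeval_X, aeval_C, Algebra.algebraMap_eq_smul_one, ← mulVec_mulVec,
    sub_mulVec, smul_mulVec, one_mulVec, dotProduct_sub, dotProduct_smul, smul_eq_mul] at h
  linarith

/-- **Every real zero lies in the spectral interval**: with the eigenvalues of `A` in `[α, β]`,
each real zero `θ` of such a `p` satisfies `α ≤ θ ≤ β` (the Ritz values lie in
`[λ_min, λ_max]`). [cite: VanDenEshofEtAl2002, §4 Lemma 5 with §3 (Ritz values);
HornJohnson2013, Thm. 4.2.2] -/
theorem root_mem_Icc {A : Matrix ι ι ℝ} (hA : A.IsHermitian) {α β : ℝ}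
    (hspec : ∀ i, hA.eigenvalues i ∈ Set.Icc α β) {b : ι → ℝ} {m : ℕ} {p : ℝ[X]}
    (hind : LinearIndependent ℝ (fun j : Fin (m + 1) => (A ^ (j : ℕ)) *ᵥ b)) (hp : p ≠ 0)
    (hpdeg : p.natDegree ≤ m) (horth : ∀ w ∈ krylov A b m, w ⬝ᵥ (aeval A p *ᵥ b) = 0)
    {θ : ℝ} (hθ : p.IsRoot θ) : θ ∈ Set.Icc α β := by
  obtain ⟨u, -, hu, hθu⟩ := exists_rayleigh_of_isRoot hind hp hpdeg horth hθ
  have hpos : 0 < u ⬝ᵥ u := dotProduct_self_pos' hu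
  obtain ⟨hlo, hhi⟩ := dotProduct_mulVec_mem_Icc hA hspec u
  rw [hθu] at hlo hhi
  exact ⟨le_of_mul_le_mul_right hlo hpos, le_of_mul_le_mul_right hhi hpos⟩

omit [Fintype ι] [DecidableEq ι] in
/-- The real quadratic `(X − Re z)² + (Im z)²` vanishes at `z`. [folklore] -/
private theorem aeval_quad_eq_zero (z : ℂ) :
    aeval z ((X - C z.re) ^ 2 + C (z.im ^ 2) : ℝ[X]) = 0 := by
  have hw : z - (z.re : ℂ) = (z.im : ℂ) * Complex.I := by
    apply Complex.ext <;> simp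
  simp only [map_add, map_pow, map_sub, aeval_X, aeval_C, Complex.coe_algebraMap]
  rw [hw, mul_pow, Complex.I_sq]
  ring

omit [Fintype ι] [DecidableEq ι] in
/-- A real polynomial of degree `≤ 1` vanishing at a non-real complex number is zero. [folklore] -/
private theorem eq_zero_of_degree_le_one_of_aeval {t : ℝ[X]} (ht : t.degree ≤ 1) {z : ℂ}
    (hzi : z.im ≠ 0) (htz : aeval z t = 0) : t = 0 := by
  have hteq := eq_X_add_C_of_degree_le_one ht
  rw [hteq] at htz
  simp only [map_add, map_mul, aeval_C, aeval_X, Complex.coe_algebraMap] at htz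
  have him := congr_arg Complex.im htz
  simp only [Complex.add_im, Complex.mul_im, Complex.ofReal_re, Complex.ofReal_im, zero_mul,
    add_zero, Complex.zero_im] at him
  have h1 : t.coeff 1 = 0 := by
    rcases mul_eq_zero.mp him with h | h
    · exact h
    · exact absurd h hzi
  have hre := congr_arg Complex.re htz
  simp only [h1, Complex.ofReal_zero, zero_mul, zero_add, Complex.ofReal_re, Complex.zero_re] at hre
  rw [hteq, h1, hre]
  simp

/-- **Every complex zero of the residual polynomial is real.**  In the no-breakdown regime, if
`p ≠ 0`, `deg p ≤ m`, `p(A) b ⊥ 𝒦_m(A, b)` for a real SYMMETRIC `A`, and `p(z) = 0` for a complex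
`z`, then `Im z = 0`.  (Otherwise the real quadratic `g = (X − Re z)² + (Im z)²` divides `p`,
`p = g q`, and `u = q(A)b ∈ 𝒦_m` gives `0 = (u, g(A)u) = ‖(A − Re z)u‖² + (Im z)²‖u‖²`, so `u = 0`,
`q = 0`, `p = 0`.)  This is the content of "the zeros of `π_k(t) = det(tI − T_k)` are the
(real) Ritz values" that the tree can state without `T_k`. [cite: VanDenEshofEtAl2002, §4 Lemma 5
(proof, "[PPV95] … π_k(t) ≡ det(tI − T_k)") and §3 (Ritz values)] -/
theorem im_eq_zero_of_aeval_eq_zero {A : Matrix ι ι ℝ} (hA : A.IsHermitian) {b : ι → ℝ} {m : ℕ}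
    {p : ℝ[X]} (hind : LinearIndependent ℝ (fun j : Fin (m + 1) => (A ^ (j : ℕ)) *ᵥ b))
    (hp : p ≠ 0) (hpdeg : p.natDegree ≤ m)
    (horth : ∀ w ∈ krylov A b m, w ⬝ᵥ (aeval A p *ᵥ b) = 0) {z : ℂ} (hz : aeval z p = 0) :
    z.im = 0 := by
  by_contra hzi
  -- the real quadratic with the conjugate pair of roots `z, z̄`
  set g : ℝ[X] := (X - C z.re) ^ 2 + C (z.im ^ 2) with hg
  have hlt : (C (z.im ^ 2)).degree < ((X - C z.re) ^ 2).degree :=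
    degree_lt_degree (by rw [natDegree_C, natDegree_pow, natDegree_X_sub_C]; norm_num)
  have hgm : g.Monic := ((monic_X_sub_C z.re).pow 2).add_of_left hlt
  have hgdeg : g.natDegree = 2 := by
    rw [hg, natDegree_add_eq_left_of_degree_lt hlt, natDegree_pow, natDegree_X_sub_C]
  -- `g ∣ p`: the remainder has degree `≤ 1` and vanishes at the non-real `z`
  have hdvd : g ∣ p := by
    rw [← modByMonic_eq_zero_iff_dvd hgm]
    have htdeg : (p %ₘ g).degree ≤ 1 := by
      by_cases ht0 : p %ₘ g = 0
      · rw [ht0, degree_zero]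
        exact bot_le
      · have h := degree_modByMonic_lt p hgm
        rw [degree_eq_natDegree hgm.ne_zero, hgdeg] at h
        have h2 : (p %ₘ g).natDegree < 2 := (natDegree_lt_iff_degree_lt ht0).mpr h
        have h3 : (p %ₘ g).natDegree ≤ 1 := by omega
        exact degree_le_of_natDegree_le h3
    refine eq_zero_of_degree_le_one_of_aeval htdeg hzi ?_
    have h := congr_arg (aeval z) (modByMonic_add_div p g)
    rwa [map_add, map_mul, aeval_quad_eq_zero z, zero_mul, add_zero, hz] at h
  obtain ⟨q, hpq⟩ := hdvd
  have hq0 : q ≠ 0 := by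
    rintro rfl
    rw [mul_zero] at hpq
    exact hp hpq
  have hqdeg : q.natDegree + 2 = p.natDegree := by
    have h := congr_arg natDegree hpq
    rw [natDegree_mul hgm.ne_zero hq0, hgdeg] at h
    omega
  -- `u = q(A) b ∈ 𝒦_m` and `(u, g(A) u) = ‖(A − a)u‖² + (Im z)²‖u‖² = 0`
  set u := aeval A q *ᵥ b with hu
  have hmem : u ∈ krylov A b m := aeval_mulVec_mem_krylov_of_natDegree_lt (by omega)
  have h := horth u hmem
  set M : Matrix ι ι ℝ := A - z.re • 1 with hM
  have hMt : Mᵀ = M := by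
    rw [hM, transpose_sub, transpose_smul, transpose_one, KyFan.transpose_eq hA]
  have hgA : aeval A g = M * M + (z.im ^ 2) • (1 : Matrix ι ι ℝ) := by
    rw [hg, map_add, map_pow, map_sub, aeval_X, aeval_C, aeval_C, Algebra.algebraMap_eq_smul_one,
      Algebra.algebraMap_eq_smul_one, hM, sq]
  rw [hpq, map_mul, ← mulVec_mulVec, hgA, add_mulVec, ← mulVec_mulVec, smul_mulVec, one_mulVec,
    dotProduct_add, dotProduct_smul, smul_eq_mul, dotProduct_mulVec, ← mulVec_transpose, hMt] at h
  -- both summands are nonnegative, the second has a positive coefficient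
  have h1 : 0 ≤ (M *ᵥ u) ⬝ᵥ (M *ᵥ u) := dotProduct_self_nonneg' _
  have h2 : 0 < z.im ^ 2 := by positivity
  have huu : u ⬝ᵥ u = 0 := by
    have h3 := dotProduct_self_nonneg' u
    nlinarith
  have hu0 : u = 0 := dotProduct_self_eq_zero.mp huu
  exact hq0 (eq_zero_of_aeval_mulVec_eq_zero hind (by omega) hu0)

/-! ### §3 The product form `p(t) = lc(p) ∏ (t − θ)` over `m` real zeros in `[α, β]` -/

omit [Fintype ι] [DecidableEq ι] in
/-- If every complex zero of the real polynomial `p` is real, then `p(t) = lc(p)·∏_{θ∈s}(t − θ)` for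
the multiset `s` of real parts of its complex zeros, which has `natDegree p` elements, each a real
zero of `p`. [folklore] -/
private theorem exists_multiset_of_roots_real {p : ℝ[X]}
    (hreal : ∀ z : ℂ, aeval z p = 0 → z.im = 0) :
    ∃ s : Multiset ℝ, Multiset.card s = p.natDegree ∧ (∀ θ ∈ s, p.IsRoot θ) ∧
      ∀ t : ℝ, p.eval t = p.leadingCoeff * (s.map fun θ => t - θ).prod := by
  classical
  set P : ℂ[X] := p.map (algebraMap ℝ ℂ) with hP
  have hcard : Multiset.card P.roots = P.natDegree := by
    rw [hP, natDegree_map]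
    exact IsAlgClosed.card_aroots_eq_natDegree
  have hprod := C_leadingCoeff_mul_prod_multiset_X_sub_C hcard
  have hlc : P.leadingCoeff = algebraMap ℝ ℂ p.leadingCoeff := by rw [hP, leadingCoeff_map]
  -- every root `w` of `P` is real: `w = ↑(w.re)`
  have hroot : ∀ w ∈ P.roots, algebraMap ℝ ℂ w.re = w := by
    intro w hw
    have hw' : aeval w p = 0 := ((mem_aroots (S := ℂ)).mp hw).2
    apply Complex.ext
    · simp
    · rw [Complex.coe_algebraMap, Complex.ofReal_im]
      exact (hreal w hw').symm
  refine ⟨P.roots.map Complex.re, ?_, ?_, ?_⟩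
  · rw [Multiset.card_map, hcard, hP, natDegree_map]
  · intro θ hθ
    obtain ⟨w, hw, rfl⟩ := Multiset.mem_map.mp hθ
    have hw' : aeval w p = 0 := ((mem_aroots (S := ℂ)).mp hw).2
    have h2 : algebraMap ℝ ℂ (p.eval w.re) = 0 := by
      rw [← eval₂_at_apply, ← aeval_def, hroot w hw]
      exact hw'
    rw [IsRoot.def]
    exact (algebraMap ℝ ℂ).injective (by rw [h2, map_zero])
  · intro t
    apply (algebraMap ℝ ℂ).injective
    have hl : algebraMap ℝ ℂ (p.eval t) = P.eval (algebraMap ℝ ℂ t) := by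
      rw [hP, eval_map, eval₂_at_apply]
    have hr : P.eval (algebraMap ℝ ℂ t) =
        algebraMap ℝ ℂ p.leadingCoeff * (P.roots.map fun w => algebraMap ℝ ℂ t - w).prod := by
      conv_lhs => rw [← hprod]
      rw [eval_mul, eval_C, eval_multiset_prod, Multiset.map_map, hlc]
      simp only [Function.comp_def, eval_sub, eval_X, eval_C]
    rw [hl, hr, map_mul, map_multiset_prod, Multiset.map_map, Multiset.map_map]
    congr 1
    refine congr_arg _ (Multiset.map_congr rfl fun w hw => ?_)
    simp only [Function.comp_apply, map_sub, hroot w hw]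

/-- **The residual polynomial is a product over `m` real zeros in the spectral interval**:
in the no-breakdown regime, for `p ≠ 0` with `deg p ≤ m`, `p(A) b ⊥ 𝒦_m(A, b)`, `A` symmetric with
spectrum in `[α, β]`: `p(t) = lc(p) · ∏_{θ ∈ s} (t − θ)` for a multiset `s` of `m` reals, all in
`[α, β]` — the tree's form of "`r_k = π_k(A) b/π_k(0)`, `π_k(t) ≡ det(tI − T_k) = ∏_j (t − θ_{j,k})`,
`θ_{j,k}` the Ritz values". [cite: VanDenEshofEtAl2002, §4 Lemma 5 (proof, [PPV95]
characterisation) and §3 ("the eigenvalues of T_k … the Ritz values")] -/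
theorem exists_multiset_eval_eq_prod {A : Matrix ι ι ℝ} (hA : A.IsHermitian) {α β : ℝ}
    (hspec : ∀ i, hA.eigenvalues i ∈ Set.Icc α β) {b : ι → ℝ} {m : ℕ} {p : ℝ[X]}
    (hind : LinearIndependent ℝ (fun j : Fin (m + 1) => (A ^ (j : ℕ)) *ᵥ b)) (hp : p ≠ 0)
    (hpdeg : p.natDegree ≤ m) (horth : ∀ w ∈ krylov A b m, w ⬝ᵥ (aeval A p *ᵥ b) = 0) :
    ∃ s : Multiset ℝ, Multiset.card s = m ∧ (∀ θ ∈ s, θ ∈ Set.Icc α β) ∧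
      ∀ t : ℝ, p.eval t = p.leadingCoeff * (s.map fun θ => t - θ).prod := by
  obtain ⟨s, hcard, hroots, heval⟩ := exists_multiset_of_roots_real
    (fun z hz => im_eq_zero_of_aeval_eq_zero hA hind hp hpdeg horth hz)
  exact ⟨s, by rw [hcard, natDegree_eq_of_galerkin hind hp hpdeg horth],
    fun θ hθ => root_mem_Icc hA hspec hind hp hpdeg horth (hroots θ hθ), heval⟩

/-! ### §4 The multi-shift factor `ζ^σ_m = ∏ θ/(θ + σ) ∈ (0, 1]` -/

/-- `1 ≤ ∏ s` when every factor is `≥ 1`. [folklore] -/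
private theorem one_le_multiset_prod {s : Multiset ℝ} (h : ∀ x ∈ s, 1 ≤ x) : 1 ≤ s.prod := by
  induction s using Multiset.induction_on with
  | empty => simp
  | cons a s ih =>
    rw [Multiset.prod_cons]
    have ha := h a (Multiset.mem_cons_self a s)
    have hs := ih fun x hx => h x (Multiset.mem_cons_of_mem hx)
    nlinarith

/-- `0 < ∏ s ≤ 1` when every factor is in `(0, 1]`. [folklore] -/
private theorem multiset_prod_mem_Ioc {s : Multiset ℝ} (h : ∀ x ∈ s, 0 < x ∧ x ≤ 1) :
    0 < s.prod ∧ s.prod ≤ 1 := by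
  induction s using Multiset.induction_on with
  | empty => simp
  | cons a s ih =>
    rw [Multiset.prod_cons]
    have ha := h a (Multiset.mem_cons_self a s)
    have hs := ih fun x hx => h x (Multiset.mem_cons_of_mem hx)
    exact ⟨mul_pos ha.1 hs.1, by nlinarith [ha.1, ha.2, hs.1, hs.2]⟩

/-- **`p_m(t) = ∏ (1 − t/θ)` and `p_m(t) ≥ 1` left of the origin.**  With the CG normalisation
`p(0) = 1`, spectrum in `[α, β] ⊂ (0, ∞)` and no breakdown, the residual polynomial satisfies
`p(t) ≥ 1` for every `t ≤ 0` (all its zeros are `≥ α > 0`); at `t = −σ` this is `ζ^σ_m ≤ 1`.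
[cite: VanDenEshofEtAl2002, §4 Lemma 5 and proof of Theorem 6 ("Since 0 ≤ φ_k ≤ 1");
Jegerlehner1996, §3.1 ("ζ_i^σ ≤ 1")] -/
theorem one_le_residualPoly_eval {A : Matrix ι ι ℝ} (hA : A.IsHermitian) {α β : ℝ} (hα : 0 < α)
    (hspec : ∀ i, hA.eigenvalues i ∈ Set.Icc α β) {b : ι → ℝ} {m : ℕ} {p : ℝ[X]}
    (hind : LinearIndependent ℝ (fun j : Fin (m + 1) => (A ^ (j : ℕ)) *ᵥ b))
    (hpdeg : p.natDegree ≤ m) (hp0 : p.eval 0 = 1)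
    (horth : ∀ w ∈ krylov A b m, w ⬝ᵥ (aeval A p *ᵥ b) = 0) {t : ℝ} (ht : t ≤ 0) :
    1 ≤ p.eval t := by
  have hp : p ≠ 0 := by
    rintro rfl
    simp at hp0
  obtain ⟨s, -, hsI, heval⟩ := exists_multiset_eval_eq_prod hA hspec hind hp hpdeg horth
  have hlc : p.leadingCoeff ≠ 0 := leadingCoeff_ne_zero.mpr hp
  have hθ : ∀ θ ∈ s, 0 < θ := fun θ hθ => lt_of_lt_of_le hα (hsI θ hθ).1
  have key : p.eval t = (s.map fun θ => 1 - t / θ).prod := by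
    calc p.eval t = p.eval t / p.eval 0 := by rw [hp0, div_one]
      _ = (s.map fun θ => t - θ).prod / (s.map fun θ => 0 - θ).prod := by
          rw [heval t, heval 0, mul_div_mul_left _ _ hlc]
      _ = (s.map fun θ => (t - θ) / (0 - θ)).prod := by rw [Multiset.prod_map_div]
      _ = (s.map fun θ => 1 - t / θ).prod := by
          refine congr_arg _ (Multiset.map_congr rfl fun θ hθs => ?_)
          have hθ0 : θ ≠ 0 := (hθ θ hθs).ne'
          field_simp
          ring
  rw [key]
  refine one_le_multiset_prod fun x hx => ?_
  obtain ⟨θ, hθs, rfl⟩ := Multiset.mem_map.mp hx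
  have : t / θ ≤ 0 := div_nonpos_of_nonpos_of_nonneg ht (hθ θ hθs).le
  linarith

/-- A linear dependence among `b, Ab, …, A^m b` is a nonzero polynomial `q` of degree `≤ m` with
`q(A) b = 0` (breakdown = the grade of `b` is `≤ m`). [cite: Saad2003, §6.2 Proposition 6.2
(proof)] -/
theorem exists_poly_of_not_linearIndependent {A : Matrix ι ι ℝ} {b : ι → ℝ} {m : ℕ}
    (h : ¬ LinearIndependent ℝ (fun j : Fin (m + 1) => (A ^ (j : ℕ)) *ᵥ b)) :
    ∃ q : ℝ[X], q ≠ 0 ∧ q.natDegree ≤ m ∧ aeval A q *ᵥ b = 0 := by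
  obtain ⟨g, hsum, i, hi⟩ := Fintype.not_linearIndependent_iff.mp h
  refine ⟨∑ j : Fin (m + 1), C (g j) * X ^ (j : ℕ), ?_, ?_, ?_⟩
  · intro hq
    have hc := congr_arg (fun q : ℝ[X] => q.coeff i) hq
    simp only [finsetSum_coeff, coeff_C_mul_X_pow, coeff_zero] at hc
    rw [Finset.sum_eq_single i] at hc
    · simp only [if_true] at hc
      exact hi hc
    · intro j _ hji
      rw [if_neg]
      exact fun hij => hji (Fin.ext hij).symm
    · intro hi'
      exact absurd (Finset.mem_univ i) hi'
  · refine natDegree_sum_le_of_forall_le _ _ fun j _ => ?_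
    calc (C (g j) * X ^ (j : ℕ)).natDegree ≤ (j : ℕ) := natDegree_C_mul_X_pow_le _ _
      _ ≤ m := Nat.lt_succ_iff.mp j.isLt
  · rw [map_sum, sum_mulVec]
    simpa only [map_mul, aeval_C, map_pow, aeval_X, Algebra.algebraMap_eq_smul_one, smul_mul_assoc,
      one_mul, smul_mulVec] using hsum

/-- **Lemma 5 of van den Eshof et al. (the multi-shift factor as a product over the zeros).**
Let `A` be symmetric positive definite with spectrum in `[α, β]`, and let `x`, `x'` be the `m`-th
Galerkin (CG) iterates of `A x = b` and `(A + σ) x' = b` from the zero initial guess, in the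
no-breakdown regime (`b, …, A^m b` independent).  Then
`b − (A + σ) x' = (∏_{θ ∈ s} θ/(θ + σ)) · (b − A x)`, where the multiset `s` of `m` reals in
`[α, β]` is the zero set of the seed residual polynomial (in print: the Ritz values `θ_{j,k}`,
eigenvalues of `T_k`); for every real `σ` for which the shifted iterate exists, `θ + σ ≠ 0`
throughout. [cite: VanDenEshofEtAl2002, §4 Lemma 5 ("r_k^τ = φ_k^τ r_k, φ_k^τ = ∏ θ_{j,k}/(θ_{j,k}+τ)")] -/
theorem IsCGIterate.shifted_residual_eq_prod_smul {A : Matrix ι ι ℝ} (hA : A.PosDef) {σ : ℝ}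
    {b x x' : ι → ℝ} {m : ℕ} (hx : IsCGIterate A b 0 m x) (hx' : IsCGIterate (A + σ • 1) b 0 m x')
    (hind : LinearIndependent ℝ (fun j : Fin (m + 1) => (A ^ (j : ℕ)) *ᵥ b))
    {α β : ℝ} (hspec : ∀ i, hA.1.eigenvalues i ∈ Set.Icc α β) :
    ∃ s : Multiset ℝ, Multiset.card s = m ∧ (∀ θ ∈ s, θ ∈ Set.Icc α β ∧ θ + σ ≠ 0) ∧
      b - (A + σ • 1) *ᵥ x' = (s.map fun θ => θ / (θ + σ)).prod • (b - A *ᵥ x) := by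
  obtain ⟨p, hpdeg, hp0, hp⟩ := hx.exists_residual_eq_aeval
  rw [residual_zero] at hp
  have hpne : p ≠ 0 := by
    rintro rfl
    simp at hp0
  have horth : ∀ w ∈ krylov A b m, w ⬝ᵥ (aeval A p *ᵥ b) = 0 := by
    intro w hw
    have h := hx.galerkin w
    rw [residual_zero, hp] at h
    exact h hw
  obtain ⟨hpσ, hres⟩ := hx.shifted_residual_eq_inv_eval_smul hx' hind hpdeg hp
  obtain ⟨s, hcard, hsI, heval⟩ := exists_multiset_eval_eq_prod hA.1 hspec hind hpne hpdeg horth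
  have hlc : p.leadingCoeff ≠ 0 := leadingCoeff_ne_zero.mpr hpne
  have hprodσ : p.eval (-σ) = p.leadingCoeff * (s.map fun θ => -σ - θ).prod := heval (-σ)
  have hprod0 : p.leadingCoeff * (s.map fun θ => 0 - θ).prod = 1 := by rw [← heval 0, hp0]
  have hθσ : ∀ θ ∈ s, θ + σ ≠ 0 := by
    intro θ hθ hzero
    apply hpσ
    rw [hprodσ, Multiset.prod_eq_zero (Multiset.mem_map.mpr ⟨θ, hθ, by linarith⟩), mul_zero]
  refine ⟨s, hcard, fun θ hθ => ⟨hsI θ hθ, hθσ θ hθ⟩, ?_⟩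
  rw [hres]
  congr 1
  calc (p.eval (-σ))⁻¹
      = (p.leadingCoeff * (s.map fun θ => 0 - θ).prod) /
          (p.leadingCoeff * (s.map fun θ => -σ - θ).prod) := by rw [hprod0, hprodσ, one_div]
    _ = (s.map fun θ => 0 - θ).prod / (s.map fun θ => -σ - θ).prod := mul_div_mul_left _ _ hlc
    _ = (s.map fun θ => (0 - θ) / (-σ - θ)).prod := by rw [Multiset.prod_map_div]
    _ = (s.map fun θ => θ / (θ + σ)).prod := by
        refine congr_arg _ (Multiset.map_congr rfl fun θ _ => ?_)
        rw [zero_sub, show -σ - θ = -(θ + σ) by ring, neg_div_neg_eq]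

/-- **`0 < ζ^σ_m ≤ 1` for non-negative shifts — unconditionally.**  For `A` symmetric positive
definite, `σ ≥ 0`, and the `m`-th Galerkin (CG) iterates `x` of `A x = b` and `x'` of
`(A + σ) x' = b` from the zero initial guess: `b − (A + σ) x' = ζ (b − A x)` with `0 < ζ ≤ 1`.
(No breakdown: `ζ = ∏ θ/(θ+σ)` with all `θ ≥ λ_min > 0`; breakdown at step `≤ m`: both residuals
vanish.)  "Since `0 ≤ φ_k^τ ≤ 1`"; "the shifted systems still converge if `ζ_i ≤ 1`".
[cite: VanDenEshofEtAl2002, §4 Lemma 5 and proof of Theorem 6; Jegerlehner1996, §2.2, §3.1] -/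
theorem IsCGIterate.exists_shifted_residual_eq_smul_of_posDef {A : Matrix ι ι ℝ} (hA : A.PosDef)
    {σ : ℝ} (hσ : 0 ≤ σ) {b x x' : ι → ℝ} {m : ℕ} (hx : IsCGIterate A b 0 m x)
    (hx' : IsCGIterate (A + σ • 1) b 0 m x') :
    ∃ ζ : ℝ, 0 < ζ ∧ ζ ≤ 1 ∧ b - (A + σ • 1) *ᵥ x' = ζ • (b - A *ᵥ x) := by
  classical
  by_cases hind : LinearIndependent ℝ (fun j : Fin (m + 1) => (A ^ (j : ℕ)) *ᵥ b)
  · -- no breakdown: `ζ = ∏ θ/(θ+σ)` with `θ ∈ [λ_min, λ_max] ⊂ (0, ∞)`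
    haveI : Nonempty ι := by
      by_contra h
      rw [not_nonempty_iff] at h
      exact hind.ne_zero 0 (Subsingleton.elim _ _)
    obtain ⟨i₀, -, hi₀⟩ := Finset.exists_mem_eq_inf' Finset.univ_nonempty hA.1.eigenvalues
    have hspec : ∀ i, hA.1.eigenvalues i ∈
        Set.Icc (Finset.univ.inf' Finset.univ_nonempty hA.1.eigenvalues)
          (Finset.univ.sup' Finset.univ_nonempty hA.1.eigenvalues) := fun i =>
      ⟨Finset.inf'_le _ (Finset.mem_univ i), Finset.le_sup' _ (Finset.mem_univ i)⟩
    have hα : 0 < Finset.univ.inf' Finset.univ_nonempty hA.1.eigenvalues := by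
      rw [hi₀]
      exact hA.eigenvalues_pos i₀
    obtain ⟨s, -, hs, hres⟩ := hx.shifted_residual_eq_prod_smul hA hx' hind hspec
    have hfac : ∀ y ∈ s.map (fun θ => θ / (θ + σ)), 0 < y ∧ y ≤ 1 := by
      intro y hy
      obtain ⟨θ, hθ, rfl⟩ := Multiset.mem_map.mp hy
      have hθpos : 0 < θ := lt_of_lt_of_le hα (hs θ hθ).1.1
      exact ⟨div_pos hθpos (by linarith), (div_le_one (by linarith)).mpr (by linarith)⟩
    obtain ⟨h0, h1⟩ := multiset_prod_mem_Ioc hfac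
    exact ⟨_, h0, h1, hres⟩
  · -- breakdown at step `≤ m`: the seed residual, in `𝒦_{m+1} ≤ 𝒦_m` and orthogonal to `𝒦_m`, is 0
    obtain ⟨q, hq0, hqdeg, hqb⟩ := exists_poly_of_not_linearIndependent hind
    have hK := krylov_le_of_aeval_mulVec_eq_zero hq0 hqdeg hqb (m + 1)
    have hr : b - A *ᵥ x = 0 := by
      have hmem : b - A *ᵥ x ∈ krylov A b (m + 1) := by
        simpa only [residual_zero] using hx.residual_mem_krylov_succ
      have hro : ∀ w ∈ krylov A b m, w ⬝ᵥ (b - A *ᵥ x) = 0 := by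
        simpa only [residual_zero] using hx.galerkin
      exact dotProduct_self_eq_zero.mp (hro _ (hK hmem))
    obtain ⟨ζ, hζ⟩ := hx.exists_shifted_residual_eq_smul hx'
    refine ⟨1, one_pos, le_rfl, ?_⟩
    rw [hζ, hr, smul_zero, smul_zero]

/-- **The seed system has the largest residual** ("`σ = 0` corresponds … to the system with the
slowest convergence", in residual 2-norm, exactly): for `A` symmetric positive definite and
`σ ≥ 0`, at every step `m` of the joint (CG-M) iteration from the zero initial guess,
`‖b − (A + σ) x'_m‖² ≤ ‖b − A x_m‖²`. [cite: Jegerlehner1996, §3.1; VanDenEshofEtAl2002, §4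
Lemma 5 with "0 ≤ φ_k ≤ 1"] -/
theorem IsCGIterate.shifted_residual_normSq_le {A : Matrix ι ι ℝ} (hA : A.PosDef) {σ : ℝ}
    (hσ : 0 ≤ σ) {b x x' : ι → ℝ} {m : ℕ} (hx : IsCGIterate A b 0 m x)
    (hx' : IsCGIterate (A + σ • 1) b 0 m x') :
    (b - (A + σ • 1) *ᵥ x') ⬝ᵥ (b - (A + σ • 1) *ᵥ x') ≤ (b - A *ᵥ x) ⬝ᵥ (b - A *ᵥ x) := by
  obtain ⟨ζ, h0, h1, h⟩ := hx.exists_shifted_residual_eq_smul_of_posDef hA hσ hx'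
  rw [h, smul_dotProduct, dotProduct_smul, smul_eq_mul, smul_eq_mul]
  have hr := dotProduct_self_nonneg' (b - A *ᵥ x)
  have hζ2 : ζ * ζ ≤ 1 := by nlinarith
  nlinarith

end ConjugateGradient

end Literature.Analysis.Matrix

end
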